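import Summits.ABC.IUTFork.Joshi.TestRealHonestPacketDH
import Summits.ABC.IUTFork.Cor312HullGainMover
import Summits.ABC.IUTFork.Cor312HullGainDyadic
import Summits.ABC.IUTFork.Cor312PinnedThetaRealSharpNegative
import HarnessLib

/-!
# Branch E TEST vs S — ADVERSARY companion for hand item (a′): the Θ-PIN ALONE is uninhabited at the honest setting over the
# Dupuy–Hilado binders, at EVERY ramified place off the bad primes (wild and `p₀ ∈ {2, 3}` included)

ADVERSARY / countermodel-test file of the abc-iut cell, branch E «type Joshi's construction, test vs S» (rung LADDER-ABC:A2.E;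
third adversary seat abc-iut-E-cx-3, gen 2). Companion of the (a′) NEG records `Joshi/TestRealPinsEquivariance.lean` p445387 /
`…Free.lean` p446181 (abc-iut-E-t41 g2) and `…Ramified.lean` p446546 / `…Mover.lean` p446855 (abc-iut-E-t16 g5), which refute the
TWO-PIN predicate `Cor312Vol.PinnedRegions` at `honestSetting` through the `q`-PIN (the unit box `e⁻¹(𝒪_L)` and a UNIT-BALL mover:
tame `p₀ ≥ 5`, cyclotomic, or dyadic with `√−1 ∈ F_v`). **No side is taken** on [IUTchIII] Cor. 3.12, on Joshi's claims or on any
author (Mochizuki / Scholze–Stix / Joshi / Dupuy–Hilado); typed ≠ proved ≠ endorsed; LOCATED, not adjudicated. PROOF-ONLY: 0 `def`,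
no notation, no `Prop` fact, no instance, no `sorry`.

## What is added here (abc-iut-E-cx-2's sharpened prediction 2026-08-26T12:20:42Z «∀ ρ, ¬ ThetaPinned» at the honest carrier)
1. **The Θ-pin ALONE fails** — `Cor312Vol.ThetaPinned` = (hρ) ∧ (pΘ), WITHOUT the `q`-pin (pq′): the records above all go through
   (pq′); here the Θ-boxes `e⁻¹(p·𝒪_L)` themselves are moved. So no repair of the `q`-side alone (other `q`-boxes, `q`-pin dropped,
   `q`-pin only up to hull) restores inhabitation at this carrier.
2. **Every ramified place `v ∣ p₀` with `e_v ≥ 2` off the bad primes** — tame or wild, `p₀ = 2, 3` included (e.g. `F = ℚ(√3)`,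
   ramified exactly over `2` and `3`, outside the unit-ball census `p₀ ≥ 5` / cyclotomic / `√−1 ∈ F_v`): instead of a unit-ball mover at
   label `0` the argument runs at labels `j = i+1 ≥ 1` with abc-iut-c312-5's AMPLIFICATION — c312-5's mover `g ∈ Real.ismDH logv v`
   expands one vector by `≥ p₀^{(e_v−1)/e_v}` (`exists_mem_ismDH_rpow_mul_norm_le`, every ramified place), hence `z^{⊗(j+1)}` by `≥ p₀`
   (`p_mul_pow_norm_le_of_two_le`), and a `p₀`-power window puts `p₀^k·z^{⊗(j+1)}` inside and its image outside ANY coordinate box.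
   Price: labels `≥ 1` are star-visible, so (hρ)'s star-triviality needs «no bad place over `p₀`» (abc-iut-w5-d044's pattern).
3. **Every radius**: the star-trivial (Ind2)-family of `exists_ind2Family_starTrivial_expands` defeats EVERY uniform-radius
   coordinate box at `(j, p₀)`, not only `e⁻¹(p·𝒪_L)` (radius `‖p‖_{p₀}`, `mem_honestSetting_thetaRegion_inr_iff`).
Main statements: `not_thetaPinned_honestSetting_DH_of_ramified` (free prime `p₀`, `v ∣ p₀`, `e_v ≥ 2`; every `ρ`, column family,
column, box prime, auxiliary data, analytic `logv`), `not_pinnedRegions(3)_honestSetting_DH_of_ramified`, and the GENUINE form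
`not_thetaPinned_honestSetting_DH_of_sq_eq_neg_one`: `√−1 ∈ F` ([IUTchI] Def. 3.1 (a): every place over `2` has `e_v ≥ 2`, c312-5
`two_le_absRamificationIdx_rescaledCompletion_two_of_sq_eq_neg_one`) and `𝕍^bad_mod` of odd residue characteristic (Def. 3.1 (b);
w5-d044 `over_ne_of_residueChar_ne`) — for `PinnedRegions` the place-free form WITHOUT the parity hypothesis is already p446855
`RamifiedPins.not_pinnedRegions_honestSetting_DH_of_sq_eq_neg_one`.

## Reading (located; R13 BY DECL `Cor312Vol.ThetaPinned`)
The typed (hρ) quantifies over EVERY packet `(j, v_ℚ)`, in particular over rational places carrying no bad place, where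
`LogShells.starAut` never reads `Φ`; there (hρ) + (pΘ) say «the Θ-box is stable under all of (Ind2) at `(j, v_ℚ)`», which
Dupuy–Hilado's lattice-automorphism Ism ([DH] §4.9) refuses at every ramified place (the settingPrVolSharp twin: abc-iut-w5-d044
p434871 / abc-iut-rp-s1 `Repair.ObstructionSS19` p442822, label `0`). For the TEST protocol nothing changes in currency: every
sentence with antecedent `ThetaPinned` / `PinnedRegions` / `PinnedRegions3` at this carrier holds VACUOUSLY as typed; the
(pΘ)+(pq′)-level records (p440805, p441827, p443555: `IndCoversQ` currency) are untouched. STILL OPEN (not decided here or in the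
records above): `F` all of whose ramified primes carry a bad place; E-cx-2's support-restricted pin `ThetaPinnedSupp` (p441977); an
isometry-only reading of (Ind2) (w5-d180 `forall_ismDH_image_closedBall_eq_iff_dvd`). [cite: DupuyHilado2025, §3.6, §3.9, §4.9]
[cite: Mochizuki2012, IUTchI Def. 3.1 (a)(b) p. 61] [cite: NeukirchANT1999, Ch. II (5.5), (7.13)] [claim: Mochizuki2012, status: disputed].
Standard axioms only; no `sorry`; R14: a `Joshi/Test*` file.
-/

noncomputable section

open Set Function NumberField IsDedekindDomain Metric
open scoped Pointwise

namespace Summit.ABC.IUTFork.Joshi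

open Thm311 Thm311.Real Cor312 Cor312Vol Literature.IUT.LogThetaLattice Literature.IUT.LogVolume
  Literature.NumberTheory.NumberFields

/-! ## 1. The honest Θ-region over a prime is a uniform-radius coordinate box (every `Aut`/`Ism`) -/

section Boxes

variable {F : Type} [Field F] [NumberField F] (X : PilotData F) {logv : PadicLogs F} (hlog : LogvAnalytic logv)
  (Aut Ism : ∀ x : Thm311.Real.Place F, Set (Carrier x ≃ₗ[ℚ] Carrier x))
  (hAut : ∀ x, LinearEquiv.refl ℚ (Carrier x) ∈ Aut x) (hIsm : ∀ x, LinearEquiv.refl ℚ (Carrier x) ∈ Ism x)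
  (M : Type) [Field M] [NumberField M]
  (archPk : ∀ (j : (thetaIndex X).Label) (vQ : (thetaIndex X).VQ), Set ((logShells X logv Aut Ism hAut hIsm).Packet j vQ))
  (archSub : ∀ (j : (thetaIndex X).Label) (v : (thetaIndex X).V),
    Set ((logShells X logv Aut Ism hAut hIsm).Packet j ((thetaIndex X).over v)))
  (Ψ : ℤ → ∀ v : (thetaIndex X).V, v ∈ (thetaIndex X).Vbad → Set ((logShells X logv Aut Ism hAut hIsm).StarPacket v))
  (act : ℤ → ∀ v : (thetaIndex X).V, v ∈ (thetaIndex X).Vbad →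
    (logShells X logv Aut Ism hAut hIsm).StarPacket v → Module.End ℚ ((logShells X logv Aut Ism hAut hIsm).StarPacket v))
  (Mmod : ℤ → ∀ j : (thetaIndex X).LabelStar, Set ((logShells X logv Aut Ism hAut hIsm).GlobalPacket j.1))
  (region : ℤ → ∀ j : (thetaIndex X).LabelStar, FinDivisor M → ∀ vQ : (thetaIndex X).VQ,
    Set ((logShells X logv Aut Ism hAut hIsm).Packet j.1 vQ))
  (col : ℤ → Column (logShells X logv Aut Ism hAut hIsm)) (n : ℤ) (p : ℕ)

/-- **The honest Θ-region over a prime `p₀` is the coordinate box of radius `‖p‖_{p₀}`** (the same at every coordinate: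
`‖p‖ = |p|_{p₀}` in every field factor, a normed `ℚ_{p₀}`-algebra): `y ∈ e⁻¹(p·𝒪_L)` iff every field-factor coordinate has norm
`≤ ‖(p : ℚ_{p₀})‖`. [cite: Mochizuki2012, IUTchIV Prop. 1.4 (i) p. 13] -/
theorem mem_honestSetting_thetaRegion_inr_iff (m : ℤ) (j : (thetaIndex X).Label) (pp : Nat.Primes) [Fact (pp : ℕ).Prime]
    (y : (logShells X logv Aut Ism hAut hIsm).Packet j (.inr pp)) :
    y ∈ (honestSetting X hlog Aut Ism hAut hIsm M archPk archSub Ψ act Mmod region col n p).thetaRegion m j (.inr pp) ↔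
      ∀ (e : (thetaIndex X).Caps j → (thetaIndex X).Fibre (.inr pp)) (jj : DIdx (pp : ℕ) ((presAt X hlog pp).kk e)),
        ‖dEquiv (pp : ℕ) ((presAt X hlog pp).kk e) ((presAt X hlog pp).comparison j y e) jj‖ ≤ ‖((p : ℕ) : ℚ_[pp])‖ := by
  rw [honestSetting_thetaRegion]
  change (presAt X hlog pp).factorMap j y ∈
    hullSet ((presAt X hlog pp).factorField j) (fun s => (p : (presAt X hlog pp).factorField j s)) ↔ _
  rw [hullSet, mem_polydisc]
  have hn : ∀ s : (presAt X hlog pp).factorIdx j, ‖(p : (presAt X hlog pp).factorField j s)‖ = ‖((p : ℕ) : ℚ_[pp])‖ :=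
    fun s => norm_natCast_eq_padicNorm (pp : ℕ) ((presAt X hlog pp).factorField j s) p
  constructor
  · intro h e jj
    have h1 := h ⟨e, jj⟩
    rw [hn] at h1
    exact h1
  · rintro h ⟨e, jj⟩
    rw [hn]
    exact h e jj

end Boxes

/-! ## 2. The mover in field-factor coordinates: a star-trivial (Ind2)-family EXPANDING past every radius -/

section Mover

variable {F : Type} [Field F] [NumberField F] (X : PilotData F) {logv : PadicLogs F} (hlog : LogvAnalytic logv)

/-- **THE STAR-TRIVIAL EXPANDING (Ind2)-FAMILY at a ramified place.** At a place `v | p₀` of `F` with `e_v ≥ 2` and a label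
`j = i+1`: some `Φ ∈ (Ind2)` of the Dupuy–Hilado-level signature `logShellsDH X logv` — abc-iut-c312-5's mover `g ∈ Real.ismDH logv v`
(`exists_mem_ismDH_rpow_mul_norm_le`: `p₀^{(e_v−1)/e_v}·‖z‖ ≤ ‖g z‖`) on every summand `v`, the identity at every other place —
(a) acts as the identity on every star packet `∏_{j ∈ 𝔽_l^⋇} 𝓘^ℚ(…;𝒟⊢_{v′})` over a rational place `≠ p₀`, and (b) for EVERY radius
`τ > 0` carries a point of the packet at `(j, p₀)` all of whose field-factor coordinates have norm `≤ τ` (the pure tensor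
`p₀^k·z^{⊗(j+1)}` at the diagonal summand `(v, …, v)`, `0` at the other summands; `k` from a `p₀`-power window below
`‖g z‖^{j+1}/‖z‖^{j+1} ≥ p₀`) to a point with a coordinate of norm `> τ`. The bookkeeping of c312-5's
`thetaLocal_settingPrVolSharp_pos_of_ramified`, verbatim. [cite: DupuyHilado2025, §3.6, §4.9] [cite: NeukirchANT1999, Ch. II (5.5)] -/
theorem exists_ind2Family_starTrivial_expands (pp : Nat.Primes) [Fact (pp : ℕ).Prime] (v : HeightOneSpectrum (𝓞 F))
    (hv : (thetaIndex X).over (.inr v) = .inr pp) (hvp : ((pp : ℕ) : 𝓞 F) ∈ v.asIdeal)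
    (he : 2 ≤ absRamificationIdx (pp : ℕ) (RescaledCompletion F (pp : ℕ) v hvp)) (i : Fin (thetaIndex X).lstar) :
    ∃ Φ ∈ (logShellsDH X logv).Ind2Family,
      (∀ v' : (thetaIndex X).V, (thetaIndex X).over v' ≠ .inr pp →
        (logShellsDH X logv).starAut Φ v' = LinearEquiv.refl ℚ _) ∧
      ∀ τ : ℝ, 0 < τ →
        ∃ x : (logShellsDH X logv).Packet (Setting.labelSucc i) (.inr pp),
          (∀ (e : (thetaIndex X).Caps (Setting.labelSucc i) → (thetaIndex X).Fibre (.inr pp))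
              (jj : DIdx (pp : ℕ) ((presAt X hlog pp).kk e)),
            ‖dEquiv (pp : ℕ) ((presAt X hlog pp).kk e) ((presAt X hlog pp).comparison (Setting.labelSucc i) x e) jj‖ ≤ τ) ∧
          ∃ (e : (thetaIndex X).Caps (Setting.labelSucc i) → (thetaIndex X).Fibre (.inr pp))
              (jj : DIdx (pp : ℕ) ((presAt X hlog pp).kk e)),
            τ < ‖dEquiv (pp : ℕ) ((presAt X hlog pp).kk e)
              ((presAt X hlog pp).comparison (Setting.labelSucc i) (Φ (Setting.labelSucc i) (.inr pp) x) e) jj‖ := by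
  classical
  have hp1 : (1 : ℝ) < (pp : ℕ) := by exact_mod_cast pp.2.one_lt
  have hp0 : (0 : ℝ) < (pp : ℕ) := zero_lt_one.trans hp1
  set x₀ : (thetaIndex X).Fibre (.inr pp) := ⟨.inr v, hv⟩ with hx₀
  set e₀ : (thetaIndex X).Caps (Setting.labelSucc i) → (thetaIndex X).Fibre (.inr pp) := fun _ => x₀ with he₀
  haveI : Nonempty ((thetaIndex X).Caps (Setting.labelSucc i)) := ⟨0⟩
  -- §2a: the mover at `v` (c312-5, gen 5: transitivity of `Real.ismDH` on primitive vectors of the log-shell lattice)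
  obtain ⟨g, hg, g', hgg', z, hz0, hzexp⟩ := exists_mem_ismDH_rpow_mul_norm_le X hlog pp v hv hvp
  -- §2b: the (Ind2)-family acting by `g` at `v` (every tensor slot, every label) and trivially at every other place
  set G : ∀ y : Thm311.Real.Place F, Carrier y ≃ₗ[ℚ] Carrier y :=
    Function.update (fun y => LinearEquiv.refl ℚ (Carrier y)) (.inr v) g with hG
  have hGv : G (.inr v) = g := by rw [hG, Function.update_self]
  have hGne : ∀ y : Thm311.Real.Place F, y ≠ .inr v → G y = LinearEquiv.refl ℚ (Carrier y) := fun y hy => by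
    rw [hG, Function.update_of_ne hy]
  have hGmem : ∀ y : Thm311.Real.Place F, G y ∈ ismDH logv y := by
    intro y
    by_cases hy : y = .inr v
    · subst hy; rw [hGv]; exact hg
    · rw [hGne y hy]; exact refl_mem_ismDH logv y
  choose g'' hg'' using fun w : (thetaIndex X).Fibre (.inr pp) => (presAt X hlog pp).ism_linear w (G w.1) (hGmem w.1)
  set Φ : (logShellsDH X logv).PacketAut := fun j' vQ' =>
    (logShellsDH X logv).factorwise j' vQ' fun _ => (logShellsDH X logv).summandwise vQ' fun w => G w.1 with hΦ
  have hΦ2 : Φ ∈ (logShellsDH X logv).Ind2Family := fun j' vQ' => ⟨fun _ w => G w.1, fun _ w => hGmem w.1, rfl⟩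
  refine ⟨Φ, hΦ2, ?_, ?_⟩
  · -- (a) star-triviality off `p₀`: every summand over `v_ℚ ≠ p₀` is a place `≠ v` (pattern of abc-iut-w5-d044, p434871)
    intro v' hover
    apply LinearEquiv.ext
    intro x
    funext j'
    show (Φ j'.1 ((thetaIndex X).over v')) (x j') = x j'
    have hw : ∀ w : (thetaIndex X).Fibre ((thetaIndex X).over v'), G w.1 = LinearEquiv.refl ℚ (Carrier w.1) := by
      intro w
      refine hGne w.1 fun hw1 => hover ?_
      rw [← w.2, hw1, hv]
    have hΦv : Φ j'.1 ((thetaIndex X).over v') = LinearEquiv.refl ℚ _ := by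
      show (logShellsDH X logv).factorwise j'.1 ((thetaIndex X).over v')
          (fun _ => (logShellsDH X logv).summandwise ((thetaIndex X).over v') fun w => G w.1) = _
      have hfun : (fun w : (thetaIndex X).Fibre ((thetaIndex X).over v') => G w.1) =
          fun w : (thetaIndex X).Fibre ((thetaIndex X).over v') =>
            LinearEquiv.refl ℚ ((logShellsDH X logv).carrier w.1) := by
        funext w; exact hw w
      rw [hfun, (logShellsDH X logv).summandwise_refl_family, (logShellsDH X logv).factorwise_refl]
    rw [hΦv]
    rfl
  · -- (b) expansion past every radius `τ`
    intro τ hτ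
    -- the `p₀`-power window: `‖z‖^N/τ ≤ p₀^k < ‖g' z‖^N/τ`, from `p₀·‖z‖^N ≤ ‖g' z‖^N` (`e_v ≥ 2`, `N = i+2 ≥ 2`)
    have hzN : 0 < ‖z‖ ^ Fintype.card ((thetaIndex X).Caps (Setting.labelSucc i)) / τ :=
      div_pos (pow_pos (norm_pos_iff.mpr hz0) _) hτ
    have hpow : ((pp : ℕ) : ℝ) * (‖z‖ ^ Fintype.card ((thetaIndex X).Caps (Setting.labelSucc i)) / τ) ≤
        ‖g' z‖ ^ Fintype.card ((thetaIndex X).Caps (Setting.labelSucc i)) / τ := by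
      rw [← mul_div_assoc]
      exact div_le_div_of_nonneg_right
        (p_mul_pow_norm_le_of_two_le (pp : ℕ) he (two_le_card_caps_labelSucc X i) hzexp) hτ.le
    obtain ⟨k, hk1, hk2⟩ := exists_zpow_mem_window (pp : ℕ) hzN hpow
    have hnk : ‖((pp : ℕ) : ℚ_[pp]) ^ k‖ = ((pp : ℕ) : ℝ) ^ (-k) := by
      rw [norm_zpow, Padic.norm_p, inv_zpow']
    set ρ' : ℝ := ((pp : ℕ) : ℝ) ^ (-k) * ‖g' z‖ ^ Fintype.card ((thetaIndex X).Caps (Setting.labelSucc i)) with hρ'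
    have hρτ : τ < ρ' := by
      rw [hρ', zpow_neg, ← div_eq_inv_mul, lt_div_iff₀ (zpow_pos hp0 k), ← lt_div_iff₀' hτ]
      exact hk2
    have hbox : ((pp : ℕ) : ℝ) ^ (-k) * ‖z‖ ^ Fintype.card ((thetaIndex X).Caps (Setting.labelSucc i)) ≤ τ := by
      rw [zpow_neg, ← div_eq_inv_mul, div_le_iff₀ (zpow_pos hp0 k), ← div_le_iff₀' hτ]
      exact hk1
    -- the family through the comparison: `⊗_a g''_{e(a)}` on the summand `e` (c312-5's naturality square)
    have hcomp : ∀ x, (presAt X hlog pp).comparison (Setting.labelSucc i) (Φ (Setting.labelSucc i) (.inr pp) x) =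
        fun e => (PiTensorProduct.congr fun a => g'' (e a) : (presAt X hlog pp).X e ≃ₗ[ℚ_[pp]] (presAt X hlog pp).X e)
          ((presAt X hlog pp).comparison (Setting.labelSucc i) x e) :=
      fun x => (presAt X hlog pp).comparison_factorwise (fun _ w => G w.1) (fun _ w => g'' w) (fun _ w y => hg'' w y) x
    have hGx : ∀ y, G x₀.1 y = g y := fun y => by
      change G (.inr v) y = g y
      rw [hGv]
    have hagree : ∀ u, g'' x₀ u = g' u := by
      intro u
      obtain ⟨y, rfl⟩ := ((presAt X hlog pp).φ x₀).surjective u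
      rw [← hg'' x₀ y, ← hgg' y]
      exact congrArg _ (hGx y)
    -- the witness: `p₀^k · z^{⊗N}` at the diagonal summand `(v, …, v)`, `0` at the other summands
    set u : (presAt X hlog pp).X e₀ := purePacket (pp : ℕ) ((presAt X hlog pp).kk e₀) fun _ => z with hu
    set w : (presAt X hlog pp).X e₀ := (((pp : ℕ) : ℚ_[pp]) ^ k) • u with hw
    have hnorm_u : ∀ jj : DIdx (pp : ℕ) ((presAt X hlog pp).kk e₀), ‖dEquiv (pp : ℕ) ((presAt X hlog pp).kk e₀) u jj‖ =
        ‖z‖ ^ Fintype.card ((thetaIndex X).Caps (Setting.labelSucc i)) := by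
      intro jj
      rw [hu, psi_purePacket_apply (pp : ℕ) ((presAt X hlog pp).kk e₀) (DFac (pp : ℕ) ((presAt X hlog pp).kk e₀))
        (dEquiv (pp : ℕ) ((presAt X hlog pp).kk e₀)), norm_prod]
      exact Finset.prod_eq_pow_card fun a _ =>
        norm_factorEmb (pp : ℕ) ((presAt X hlog pp).kk e₀) (DFac (pp : ℕ) ((presAt X hlog pp).kk e₀))
          (dEquiv (pp : ℕ) ((presAt X hlog pp).kk e₀)) a jj _
    have hnorm_w : ∀ jj : DIdx (pp : ℕ) ((presAt X hlog pp).kk e₀), ‖dEquiv (pp : ℕ) ((presAt X hlog pp).kk e₀) w jj‖ =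
        ((pp : ℕ) : ℝ) ^ (-k) * ‖z‖ ^ Fintype.card ((thetaIndex X).Caps (Setting.labelSucc i)) := by
      intro jj
      rw [hw, map_smul, Pi.smul_apply, norm_smul, hnk, hnorm_u]
    have hgu : (PiTensorProduct.congr fun a => g'' (e₀ a) :
          (presAt X hlog pp).X e₀ ≃ₗ[ℚ_[pp]] (presAt X hlog pp).X e₀) u =
        purePacket (pp : ℕ) ((presAt X hlog pp).kk e₀) fun _ => g' z := by
      rw [hu, purePacket, purePacket, PiTensorProduct.congr_tprod]
      exact congrArg _ (funext fun a => hagree z)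
    have hnorm_gw : ∀ jj : DIdx (pp : ℕ) ((presAt X hlog pp).kk e₀),
        ‖dEquiv (pp : ℕ) ((presAt X hlog pp).kk e₀) ((PiTensorProduct.congr fun a => g'' (e₀ a) :
          (presAt X hlog pp).X e₀ ≃ₗ[ℚ_[pp]] (presAt X hlog pp).X e₀) w) jj‖ = ρ' := by
      intro jj
      rw [hw, map_smul, hgu, map_smul, Pi.smul_apply, norm_smul, hnk,
        psi_purePacket_apply (pp : ℕ) ((presAt X hlog pp).kk e₀) (DFac (pp : ℕ) ((presAt X hlog pp).kk e₀))
          (dEquiv (pp : ℕ) ((presAt X hlog pp).kk e₀)), norm_prod, hρ']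
      exact congrArg _ (Finset.prod_eq_pow_card fun a _ =>
        norm_factorEmb (pp : ℕ) ((presAt X hlog pp).kk e₀) (DFac (pp : ℕ) ((presAt X hlog pp).kk e₀))
          (dEquiv (pp : ℕ) ((presAt X hlog pp).kk e₀)) a jj _)
    obtain ⟨x, hx⟩ := (presAt X hlog pp).comparison_surjective (Setting.labelSucc i) (Pi.single e₀ w)
    refine ⟨x, fun e jj => ?_, e₀, Classical.arbitrary _, ?_⟩
    · rw [hx]
      by_cases hee : e = e₀
      · subst hee
        rw [Pi.single_eq_same, hnorm_w]
        exact hbox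
      · rw [Pi.single_eq_of_ne hee, map_zero, Pi.zero_apply, norm_zero]
        exact hτ.le
    · simp only [hcomp x, hx, Pi.single_eq_same, hnorm_gw]
      exact hρτ

end Mover

/-! ## 3. At the Dupuy–Hilado binders: NO Θ-pinned reading of the honest setting (ramified place off the bad primes) -/

section DH

variable {F : Type} [Field F] [NumberField F] (X : PilotData F) {logv : PadicLogs F} (hlog : LogvAnalytic logv)
  {M : Type} [Field M] [NumberField M]
  {archPk : ∀ (j : (thetaIndex X).Label) (vQ : (thetaIndex X).VQ), Set ((logShellsDH X logv).Packet j vQ)}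
  {archSub : ∀ (j : (thetaIndex X).Label) (v : (thetaIndex X).V), Set ((logShellsDH X logv).Packet j ((thetaIndex X).over v))}
  {Ψ : ℤ → ∀ v : (thetaIndex X).V, v ∈ (thetaIndex X).Vbad → Set ((logShellsDH X logv).StarPacket v)}
  {act : ℤ → ∀ v : (thetaIndex X).V, v ∈ (thetaIndex X).Vbad →
    (logShellsDH X logv).StarPacket v → Module.End ℚ ((logShellsDH X logv).StarPacket v)}
  {Mmod : ℤ → ∀ j : (thetaIndex X).LabelStar, Set ((logShellsDH X logv).GlobalPacket j.1)}
  {region : ℤ → ∀ j : (thetaIndex X).LabelStar, FinDivisor M → ∀ vQ : (thetaIndex X).VQ, Set ((logShellsDH X logv).Packet j.1 vQ)}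
  {col : ℤ → Column (logShellsDH X logv)} {n : ℤ} {p : ℕ} [hp : Fact p.Prime]
  (ρ : (∀ v : (thetaIndex X).V, v ∈ (thetaIndex X).Vbad → Set ((logShellsDH X logv).StarPacket v)) →
    ∀ (j : (thetaIndex X).Label) (vQ : (thetaIndex X).VQ), Set ((logShellsDH X logv).Packet j vQ))
  (qK : ∀ v : (thetaIndex X).V, v ∈ (thetaIndex X).Vbad → Set ((logShellsDH X logv).StarPacket v))

/-- **NO Θ-PINNED READING of the honest setting at the Dupuy–Hilado binders when `F` has a ramified place off the bad primes.**
For a prime `p₀` carrying no bad place and a place `v | p₀` of `F` with `e_v ≥ 2`: for EVERY region-forming operator `ρ` (every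
column family `col`, column `n`, box prime `p`, analytic `logv`), the Θ-pin `Cor312Vol.ThetaPinned` — (hρ) equivariance under
`⟨(Ind1) ∪ (Ind2)⟩` together with (pΘ) — FAILS at `honestSetting` over `latticeSituationReal … stripAutDH (ismDH logv) …`: §2's
star-trivial (Ind2)-family fixes every Θ-region under the pin (abc-iut-w5-d044 `Cor312Vol.image_thetaRegion_eq_of_thetaPinned`)
but carries a point of the Θ-box `e⁻¹(p·𝒪_L)` at `(1, p₀)` (§1: the coordinate box of radius `‖p‖_{p₀}`) outside it. Tame or wild,
any `p₀`; the `q`-pin is not used. A LOCATED property of OUR typed signature; no judgement on print.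
[cite: DupuyHilado2025, §3.9, §4.9] [claim: Mochizuki2012, status: disputed] -/
theorem not_thetaPinned_honestSetting_DH_of_ramified (pp : Nat.Primes) [Fact (pp : ℕ).Prime]
    (hbad : ∀ v' ∈ (thetaIndex X).Vbad, (thetaIndex X).over v' ≠ .inr pp)
    (v : HeightOneSpectrum (𝓞 F)) (hv : (thetaIndex X).over (.inr v) = .inr pp) (hvp : ((pp : ℕ) : 𝓞 F) ∈ v.asIdeal)
    (he : 2 ≤ absRamificationIdx (pp : ℕ) (RescaledCompletion F (pp : ℕ) v hvp)) :
    ¬ ThetaPinned (latticeSituationReal X hlog stripAutDH (ismDH logv) refl_mem_stripAutDH (refl_mem_ismDH logv) M archPk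
        archSub Ψ act Mmod region col)
      (honestSetting X hlog stripAutDH (ismDH logv) refl_mem_stripAutDH (refl_mem_ismDH logv) M archPk archSub Ψ act Mmod
        region col n p) ρ := by
  intro hpin
  set i₀ : Fin (thetaIndex X).lstar := ⟨0, lt_of_lt_of_le Nat.zero_lt_two (thetaIndex X).two_le_lstar⟩ with hi₀
  obtain ⟨Φ, hΦ2, hstar, hmov⟩ := exists_ind2Family_starTrivial_expands X hlog pp v hv hvp he i₀
  have hτ : 0 < ‖((p : ℕ) : ℚ_[pp])‖ := norm_pos_iff.mpr (Nat.cast_ne_zero.mpr hp.out.ne_zero)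
  obtain ⟨x, hxin, e, jj, hxout⟩ := hmov _ hτ
  -- no bad place lies over `p₀`: `Φ` acts trivially on every bad-place star packet
  have hstar' : ∀ (v' : (thetaIndex X).V) (_ : v' ∈ (thetaIndex X).Vbad) (A : Set ((logShellsDH X logv).StarPacket v')),
      (logShellsDH X logv).starAut Φ v' '' A = A := fun v' hv' A => by
    rw [hstar v' (hbad v' hv')]
    exact Set.image_id _
  -- under the Θ-pin such a `Φ` FIXES the Θ-region at `(i₀+1, p₀)` (abc-iut-w5-d044)
  have himg := Cor312Vol.image_thetaRegion_eq_of_thetaPinned hpin (Subgroup.subset_closure (Or.inr hΦ2)) hstar' 0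
    (Setting.labelSucc i₀) (.inr pp)
  have hx := (mem_honestSetting_thetaRegion_inr_iff X hlog stripAutDH (ismDH logv) refl_mem_stripAutDH (refl_mem_ismDH logv)
    M archPk archSub Ψ act Mmod region col n p 0 (Setting.labelSucc i₀) pp x).mpr hxin
  have hΦx := (Set.ext_iff.mp himg (Φ (Setting.labelSucc i₀) (.inr pp) x)).mp (Set.mem_image_of_mem _ hx)
  have hle := (mem_honestSetting_thetaRegion_inr_iff X hlog stripAutDH (ismDH logv) refl_mem_stripAutDH (refl_mem_ismDH logv) M
    archPk archSub Ψ act Mmod region col n p 0 (Setting.labelSucc i₀) pp _).mp hΦx e jj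
  exact absurd hle (not_le.mpr hxout)

/-- Hence NO reading satisfies PR-1's two pins `PinnedRegions = ThetaPinned ∧ QPinned` there, whatever the `q`-datum `qK` —
the conclusion of p445387 / p446181 / p446546 / p446855, now at every ramified place off the bad primes (`p₀ = 2, 3` and wild
ramification included) and without touching the `q`-pin. [claim: Mochizuki2012, status: disputed] -/
theorem not_pinnedRegions_honestSetting_DH_of_ramified (pp : Nat.Primes) [Fact (pp : ℕ).Prime]
    (hbad : ∀ v' ∈ (thetaIndex X).Vbad, (thetaIndex X).over v' ≠ .inr pp)
    (v : HeightOneSpectrum (𝓞 F)) (hv : (thetaIndex X).over (.inr v) = .inr pp) (hvp : ((pp : ℕ) : 𝓞 F) ∈ v.asIdeal)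
    (he : 2 ≤ absRamificationIdx (pp : ℕ) (RescaledCompletion F (pp : ℕ) v hvp)) :
    ¬ PinnedRegions (latticeSituationReal X hlog stripAutDH (ismDH logv) refl_mem_stripAutDH (refl_mem_ismDH logv) M archPk
        archSub Ψ act Mmod region col)
      (honestSetting X hlog stripAutDH (ismDH logv) refl_mem_stripAutDH (refl_mem_ismDH logv) M archPk archSub Ψ act Mmod
        region col n p) ρ qK :=
  fun h => not_thetaPinned_honestSetting_DH_of_ramified X hlog ρ pp hbad v hv hvp he h.1

/-- … nor the three pins `PinnedRegions3` (whatever the link pin): every `GapA3` / `GapH3` / «pins ⟹ ¬S» sentence at this carrier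
holds VACUOUSLY as typed. [claim: Mochizuki2012, status: disputed] -/
theorem not_pinnedRegions3_honestSetting_DH_of_ramified (pp : Nat.Primes) [Fact (pp : ℕ).Prime]
    (hbad : ∀ v' ∈ (thetaIndex X).Vbad, (thetaIndex X).over v' ≠ .inr pp)
    (v : HeightOneSpectrum (𝓞 F)) (hv : (thetaIndex X).over (.inr v) = .inr pp) (hvp : ((pp : ℕ) : 𝓞 F) ∈ v.asIdeal)
    (he : 2 ≤ absRamificationIdx (pp : ℕ) (RescaledCompletion F (pp : ℕ) v hvp)) :
    ¬ PinnedRegions3 (latticeSituationReal X hlog stripAutDH (ismDH logv) refl_mem_stripAutDH (refl_mem_ismDH logv) M archPk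
        archSub Ψ act Mmod region col)
      (honestSetting X hlog stripAutDH (ismDH logv) refl_mem_stripAutDH (refl_mem_ismDH logv) M archPk archSub Ψ act Mmod
        region col n p) ρ qK :=
  fun h => not_thetaPinned_honestSetting_DH_of_ramified X hlog ρ pp hbad v hv hvp he h.1.1

/-! ### The genuine form: `√−1 ∈ F` ([IUTchI] Def. 3.1 (a)) and `𝕍^bad` of odd residue characteristic (Def. 3.1 (b)) -/

/-- **GENUINE FORM — NO Θ-PINNED READING of the honest setting at the Dupuy–Hilado binders for any `F ∋ √−1` with `S` of odd
residue characteristic.** [IUTchI] Def. 3.1 (a) requires `√−1 ∈ F`, so every place of `F` over `2` has `e_v ≥ 2` (c312-5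
`two_le_absRamificationIdx_rescaledCompletion_two_of_sq_eq_neg_one`, Neukirch II (7.13)); Def. 3.1 (b) takes the bad places of odd
residue characteristic, so none lies over `2` (w5-d044 `over_ne_of_residueChar_ne`); a place over `2` exists (`fibre_nonempty`).
Hence `¬ ThetaPinned` for EVERY `ρ`, column family, column, box prime and analytic `logv`. (For the two-pin `PinnedRegions`
the place-free form without the parity hypothesis is p446855 `RamifiedPins.not_pinnedRegions_honestSetting_DH_of_sq_eq_neg_one`.)
[cite: Mochizuki2012, IUTchI Def. 3.1 (a)(b) p. 61] [cite: NeukirchANT1999, Ch. II (7.13)] [claim: Mochizuki2012, status: disputed] -/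
theorem not_thetaPinned_honestSetting_DH_of_sq_eq_neg_one (hF : ∃ i : F, i ^ 2 = -1)
    (hodd : ∀ v' ∈ X.S, residueChar F v' ≠ 2) :
    ¬ ThetaPinned (latticeSituationReal X hlog stripAutDH (ismDH logv) refl_mem_stripAutDH (refl_mem_ismDH logv) M archPk
        archSub Ψ act Mmod region col)
      (honestSetting X hlog stripAutDH (ismDH logv) refl_mem_stripAutDH (refl_mem_ismDH logv) M archPk archSub Ψ act Mmod
        region col n p) ρ := by
  haveI : Fact (Nat.Prime 2) := ⟨Nat.prime_two⟩
  obtain ⟨r, hr⟩ := hF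
  obtain ⟨x, hx⟩ := (thetaIndex X).fibre_nonempty (.inr ⟨2, Nat.prime_two⟩)
  rcases x with w | v
  · exact absurd hx (by simp [thetaIndex])
  · have hvp : ((2 : ℕ) : 𝓞 F) ∈ v.asIdeal := natCast_mem_placeOf X 2 ⟨.inr v, hx⟩
    exact not_thetaPinned_honestSetting_DH_of_ramified X hlog ρ ⟨2, Nat.prime_two⟩
      (over_ne_of_residueChar_ne X ⟨2, Nat.prime_two⟩ hodd) v hx hvp
      (two_le_absRamificationIdx_rescaledCompletion_two_of_sq_eq_neg_one r hr v hvp)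

end DH

end Summit.ABC.IUTFork.Joshi

end
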